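import Literature.MathematicalPhysics.QuantumLattice.SectorisedEffectiveActionBound
import Literature.MathematicalPhysics.QuantumLattice.GrassmannChargeScaling
import HarnessLib

/-!
# The sectorised single-scale step (S1) with the support hypothesis moved from the INPUT to the SLICE and the OUTPUT family

Topic `MathematicalPhysics/QuantumLattice`; sequel of `SectorisedEffectiveActionBound`.  There, the step
`hubbardSectorKernelNorm_effAction_le_of_sectorNorm` (Benfatto–Giuliani–Mastropietro 2006, (2.77)) carries the hypothesis

  `hsupp : ∀ m K, kernel ℂ G m K ≠ 0 → ∀ i, Σ_ω F ω (K i).1.1 = 1`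

— every leg of every kernel of the INPUT `G` lies in the plateau `{k : Σ_ω F_ω(k) = 1}` of the input family `F`.  An
effective action never satisfies it literally (its kernels are defined at all momenta), and in a multiscale scheme whose
field cutoffs and sector families are offset (the KL programme: the plateau of the thin family of index `n` is `{t ≤ Λ_{n+1}}`
while the fields still to be integrated after step `n` live on `{t < Λ_n}`) the hypothesis cannot be met by the natural
input either.  It is also unnecessary: the Gaussian step only reads the input where the slice covariance and the measured
output legs live.  This file proves the step with `hsupp` REPLACED by two conditions that do not mention `G`:

  `Σ_ω F_ω = 1` on the momenta of the support of the slice covariance `C`, and on the support of the OUTPUT family `F′`.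

Mechanism (three exact identities, no estimate is touched):
* `map_sectorSub_sectorPreimage_eq_map_mulLeft` — for EVERY `G`, the push-forward of the sector preimage is `G` with each
  leg multiplied by the plateau function `R = Σ_ω F_ω`: `map (toLin' S(F̃)) (sectorPreimage β F G) = S_R G` (so `hsupp` was
  exactly the statement `S_R G = G`); only `F̃ F = F` and `Σ_ω F_ω(k) = 0 ⇒ F_ω(k) = 0` are used;
* dead variables (`GrassmannLinearSubstitution.effAction_map_mulLeft_of_covariance`, `effPartitionFn_map`): `R = 1` on the
  support of `C` gives `effAction C (S_R G) = S_R (effAction C G)` and `Z(C, S_R G) = Z(C, G)`;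
* `toLin'_sectorAnalysis_comp_mulLeft` — `R = 1` on the support of `F′` gives `E(F′) ∘ S_R = E(F′)`: the measurement in the
  output family does not see `S_R`.

Results: `kernelNorm_sectorAnalysis_effAction_le_of_plateau`, `hubbardSectorKernelNorm_effAction_le_of_plateau`,
**`hubbardSectorKernelNorm_effAction_le_of_sectorNorm_of_plateau`** — same data and SAME conclusion as the originals
(`∫dμ_C e^{-G}` is a unit; the (2.77) bound in every degree with the input norm `‖G‖_{F, univ}`), for any even `G` without
constant part.  Everything is proved; no definitions; no named facts.

## Sources

G. Benfatto, A. Giuliani, V. Mastropietro, Ann. Henri Poincaré 7 (2006) 809–898 = arXiv:cond-mat/0507686, §2.5 (2.48),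
§2.7 (2.70), §2.8 (2.76)–(2.83) [`BenfattoGiulianiMastropietro2006`]; M. Salmhofer, *Renormalization* (1999), App. B.2
(B.23)–(B.25) [`Salmhofer1999`].
-/

noncomputable section

namespace Literature.MathematicalPhysics.QuantumLattice

open GrassmannAlgebra Finset Literature.Probability.LatticeModels
open scoped InnerProductSpace

variable {L M : ℕ} [NeZero L] {N N' : ℕ}

/-! ### The push-forward of the sector preimage for an arbitrary input -/

section Preimage

/-- The sectorised kernels of `S_R G` (`R = Σ_ω F_ω` leg-wise) for the normalised family `F/R` are the sectorised kernels of
`G` for `F` (where `R = 0` every `F_ω` vanishes). [cite: BenfattoGiulianiMastropietro2006, §2.7 (2.70)] -/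
theorem sectorisedKernel_div_plateau_map_mulLeft (β : ℝ) (F : Fin N → FreqMomentum L M → ℂ)
    (hF0 : ∀ k, ∑ ω, F ω k = 0 → ∀ ω, F ω k = 0) (G : HubbardGrassmann L M) (m : ℕ) (Ω : Fin m → SectorLeg N)
    (x : Fin m → SpaceTimeIdx L M) :
    sectorisedKernel L M β (fun ω k => if ∑ ω', F ω' k = 0 then 0 else F ω k / ∑ ω', F ω' k)
        (ExteriorAlgebra.map (LinearMap.mulLeft ℂ (fun K : HubbardFieldIdx L M => ∑ ω, F ω K.1.1)) G) m Ω x =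
      sectorisedKernel L M β F G m Ω x := by
  rw [sectorisedKernel_def, sectorisedKernel_def]
  refine sum_congr rfl fun k _ => ?_
  rw [kernel_map_mulLeft]
  have hFR : ∀ (ω : Fin N) (k : FreqMomentum L M),
      (if ∑ ω', F ω' k = 0 then 0 else F ω k / ∑ ω', F ω' k) * ∑ ω', F ω' k = F ω k := by
    intro ω k
    by_cases h : ∑ ω', F ω' k = 0
    · rw [if_pos h, zero_mul, hF0 k h ω]
    · rw [if_neg h, div_mul_cancel₀ _ h]
  calc (∏ i, (if ∑ ω', F ω' (k i) = 0 then 0 else F (Ω i).1.1 (k i) / ∑ ω', F ω' (k i)) *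
          hubbardPlaneWave L M β (Ω i).2 (k i) (x i)) *
        ((∏ i, ∑ ω, F ω (k i)) * kernel ℂ G m (fun i => ((k i, (Ω i).1.2), (Ω i).2)))
      = (∏ i, ((if ∑ ω', F ω' (k i) = 0 then 0 else F (Ω i).1.1 (k i) / ∑ ω', F ω' (k i)) * ∑ ω', F ω' (k i)) *
          hubbardPlaneWave L M β (Ω i).2 (k i) (x i)) * kernel ℂ G m (fun i => ((k i, (Ω i).1.2), (Ω i).2)) := by
        rw [prod_mul_distrib, prod_mul_distrib, prod_mul_distrib]; ring
    _ = _ := by simp_rw [hFR]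

variable [NeZero M]

/-- **The push-forward of the sector preimage of an ARBITRARY `G`** (BGM 2006, (2.70) with (2.48), without a support
hypothesis): if `F̃_ω F_ω = F_ω` and `Σ_ω F_ω(k) = 0` forces every `F_ω(k) = 0`, then
`map (toLin' (sectorSubMatrix β F̃)) (sectorPreimage β F G) = S_R G` with `R = Σ_ω F_ω` read on the momentum of each leg —
`G` with every leg multiplied by the plateau function of the family.  (`map_sectorSub_sectorPreimage` is the case `R = 1`
on the legs of `G`.) [cite: BenfattoGiulianiMastropietro2006, §2.7 (2.70)] -/
theorem map_sectorSub_sectorPreimage_eq_map_mulLeft {β : ℝ} (hβ : β ≠ 0) (F Ft : Fin N → FreqMomentum L M → ℂ)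
    (hFF : ∀ ω k, Ft ω k * F ω k = F ω k) (hF0 : ∀ k, ∑ ω, F ω k = 0 → ∀ ω, F ω k = 0) (G : HubbardGrassmann L M) :
    ExteriorAlgebra.map (Matrix.toLin' (sectorSubMatrix L M β Ft)) (sectorPreimage β F G) =
      ExteriorAlgebra.map (LinearMap.mulLeft ℂ (fun K : HubbardFieldIdx L M => ∑ ω, F ω K.1.1)) G := by
  -- the normalised family `F/R`
  set Fh : Fin N → FreqMomentum L M → ℂ := fun ω k => if ∑ ω', F ω' k = 0 then 0 else F ω k / ∑ ω', F ω' k with hFh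
  set G' : HubbardGrassmann L M :=
    ExteriorAlgebra.map (LinearMap.mulLeft ℂ (fun K : HubbardFieldIdx L M => ∑ ω, F ω K.1.1)) G with hG'
  -- `F̃ (F/R) = F/R`
  have hFtFh : ∀ ω k, Ft ω k * Fh ω k = Fh ω k := by
    intro ω k
    simp only [hFh]
    split_ifs with h
    · rw [mul_zero]
    · rw [← mul_div_assoc, hFF]
  -- the preimages agree
  have hpre : sectorPreimage β Fh G' = sectorPreimage β F G := by
    unfold sectorPreimage
    refine sum_congr rfl fun m _ => ?_
    congr 1
    funext Y
    rw [sectorisedKernel_div_plateau_map_mulLeft β F hF0 G m]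
  -- the legs of `S_R G` lie in the plateau of `F/R`
  have hsupp : ∀ (m : ℕ) (K : Fin m → HubbardFieldIdx L M), kernel ℂ G' m K ≠ 0 → ∀ i, ∑ ω, Fh ω (K i).1.1 = 1 := by
    intro m K hK i
    rw [hG', kernel_map_mulLeft] at hK
    have hR : ∑ ω, F ω (K i).1.1 ≠ 0 := (prod_ne_zero_iff.1 (left_ne_zero_of_mul hK)) i (mem_univ i)
    simp only [hFh, if_neg hR]
    rw [← sum_div, div_self hR]
  rw [← hpre]
  exact map_sectorSub_sectorPreimage hβ Fh Ft hFtFh G' hsupp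

end Preimage

/-! ### The output family does not see the plateau rescaling -/

section Analysis

/-- If `c = 1` on every momentum–spin–charge index read by the family `F′`, then `E(F′) · diag c = E(F′)`
(the analysis map of BGM 2006 (2.70) reads only momenta in the support of `F′`). [cite: BenfattoGiulianiMastropietro2006, §2.7 (2.70)] -/
theorem sectorAnalysisMatrix_mul_diagonal_of_eq_one (β : ℝ) (F' : Fin N' → FreqMomentum L M → ℂ)
    (c : HubbardFieldIdx L M → ℂ) (hc : ∀ (ω' : Fin N') (K : HubbardFieldIdx L M), F' ω' K.1.1 ≠ 0 → c K = 1) :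
    sectorAnalysisMatrix L M β F' * Matrix.diagonal c = sectorAnalysisMatrix L M β F' := by
  ext Y K
  rw [Matrix.mul_diagonal, sectorAnalysisMatrix_apply]
  split_ifs with h
  · by_cases hF : F' Y.2.1.1 K.1.1 = 0
    · rw [hF, zero_mul, zero_mul]
    · rw [hc _ _ hF, mul_one]
  · rw [zero_mul]

/-- **The analysis map of `F′` absorbs a rescaling that is `1` on its support**: `toLin' E(F′) ∘ S_c = toLin' E(F′)`
(BGM 2006 (2.70): the sectorised kernels depend on the kernel only through its values on the support of the family). [cite: BenfattoGiulianiMastropietro2006, §2.7 (2.70)] -/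
theorem toLin'_sectorAnalysis_comp_mulLeft (β : ℝ) (F' : Fin N' → FreqMomentum L M → ℂ)
    (c : HubbardFieldIdx L M → ℂ) (hc : ∀ (ω' : Fin N') (K : HubbardFieldIdx L M), F' ω' K.1.1 ≠ 0 → c K = 1) :
    Matrix.toLin' (sectorAnalysisMatrix L M β F') ∘ₗ LinearMap.mulLeft ℂ c = Matrix.toLin' (sectorAnalysisMatrix L M β F') := by
  apply LinearMap.toMatrix'.injective
  rw [LinearMap.toMatrix'_comp, LinearMap.toMatrix'_toLin', toMatrix'_mulLeft,
    sectorAnalysisMatrix_mul_diagonal_of_eq_one β F' c hc]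

end Analysis

/-! ### The single-scale step with plateau conditions on the slice and the output family -/

section Step

variable [NeZero M]

/-- **The single-scale step in the sectorised representation, plateau form.**  Data as in
`kernelNorm_sectorAnalysis_effAction_le` EXCEPT that the input `G` (even, no constant part) is arbitrary; instead the
plateau function `R = Σ_ω F_ω` of the input family equals `1` on the momenta of the support of the slice covariance `C`
(`hCpl`) and on the support of the output family `F′` (`hF'pl`), and `Σ_ω F_ω(k) = 0 ⇒ F_ω(k) = 0` (`hF0`).  THEN
`∫ dμ_C e^{-G}` is a unit and, in every degree `m + 1`,
`‖kernel (map (toLin' E(F′)) (effAction C G)) (m+1)‖_{ε_x} ≤ cr cc^m ε_x^m ρ^{-(m+1)} e‖Ṽ‖_h/(1-θ)`, `Ṽ = sectorPreimage β F G`.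
[cite: BenfattoGiulianiMastropietro2006, (2.77) with (2.71a) and (2.80)-(2.82)] -/
theorem kernelNorm_sectorAnalysis_effAction_le_of_plateau {E : Type*} [NormedAddCommGroup E] [InnerProductSpace ℂ E]
    {β : ℝ} (hβ : 0 < β) (F Ft : Fin N → FreqMomentum L M → ℂ) (hFF : ∀ ω k, Ft ω k * F ω k = F ω k)
    (hF0 : ∀ k, ∑ ω, F ω k = 0 → ∀ ω, F ω k = 0)
    (F' : Fin N' → FreqMomentum L M → ℂ) (G : HubbardGrassmann L M) (hG : G ∈ evenPart ℂ (HubbardFieldIdx L M))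
    (hG0 : constPart ℂ G = 0)
    (C : Matrix (HubbardFieldIdx L M) (HubbardFieldIdx L M) ℂ)
    (hCpl : ∀ X Y, C X Y ≠ 0 → ∑ ω, F ω X.1.1 = 1 ∧ ∑ ω, F ω Y.1.1 = 1)
    (hF'pl : ∀ (ω' : Fin N') (k : FreqMomentum L M), F' ω' k ≠ 0 → ∑ ω, F ω k = 1)
    (q : SpaceTimeIdx L M × SectorLeg N → Bool)
    (hC : ∀ X Y, q X = q Y → ((sectorSubMatrix L M β Ft).transpose * C * sectorSubMatrix L M β Ft) X Y = 0)
    (fv gv : SpaceTimeIdx L M × SectorLeg N → E) {κ : ℝ} (hκ : 0 < κ) (hf : ∀ X, q X = true → ‖fv X‖ ≤ κ)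
    (hg : ∀ Y, q Y = false → ‖gv Y‖ ≤ κ)
    (hGram : ∀ X Y, q X = true → q Y = false →
      contr ℂ ((sectorSubMatrix L M β Ft).transpose * C * sectorSubMatrix L M β Ft) X Y = ⟪fv X, gv Y⟫_ℂ)
    {α : ℝ} (hα : 0 < α)
    (hrow : ∀ X, ∑ Y, ‖((sectorSubMatrix L M β Ft).transpose * C * sectorSubMatrix L M β Ft) X Y‖ ≤ α)
    (hcol : ∀ Y, ∑ X, ‖((sectorSubMatrix L M β Ft).transpose * C * sectorSubMatrix L M β Ft) X Y‖ ≤ α)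
    {ρ : ℝ} (hρ : 0 < ρ)
    (hθ : Real.exp 1 * α * normV (SpaceTimeIdx L M × SectorLeg N) κ ρ
      (fun m' => kernelNorm 1 (2 * m') (kernel ℂ (sectorPreimage β F G) (2 * m'))) / κ ^ 2 < 1)
    {cr cc : ℝ} (hcr0 : 0 ≤ cr) (hcc0 : 0 ≤ cc)
    (hrow' : ∀ X'', ∑ X', ‖(sectorAnalysisMatrix L M β F' * sectorSubMatrix L M β Ft) X'' X'‖ ≤ cr)
    (hcol' : ∀ X', ∑ X'', ‖(sectorAnalysisMatrix L M β F' * sectorSubMatrix L M β Ft) X'' X'‖ ≤ cc) :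
    IsUnit (effPartitionFn ℂ C G) ∧ ∀ m : ℕ,
      kernelNorm (imagTimeWeight β M) (m + 1)
          (kernel ℂ (ExteriorAlgebra.map (Matrix.toLin' (sectorAnalysisMatrix L M β F')) (effAction ℂ C G)) (m + 1)) ≤
        cr * cc ^ m * imagTimeWeight β M ^ m * (ρ⁻¹ ^ (m + 1) *
          (Real.exp 1 * normV (SpaceTimeIdx L M × SectorLeg N) κ ρ
            (fun m' => kernelNorm 1 (2 * m') (kernel ℂ (sectorPreimage β F G) (2 * m')))) /
            (1 - Real.exp 1 * α * normV (SpaceTimeIdx L M × SectorLeg N) κ ρ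
              (fun m' => kernelNorm 1 (2 * m') (kernel ℂ (sectorPreimage β F G) (2 * m'))) / κ ^ 2)) := by
  -- the plateau rescaling `S_R`
  set Rf : HubbardFieldIdx L M → ℂ := fun K => ∑ ω, F ω K.1.1 with hRf
  have hpre := map_sectorSub_sectorPreimage_eq_map_mulLeft hβ.ne' F Ft hFF hF0 G
  -- the step for `Ṽ`, whose push-forward is `S_R G`
  have h := kernelNorm_kernel_map_effAction_le C (Matrix.toLin' (sectorSubMatrix L M β Ft))
    (Matrix.toLin' (sectorAnalysisMatrix L M β F')) (sectorPreimage β F G) (sectorPreimage_mem_evenPart β F hG)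
    (by rw [constPart_sectorPreimage, hG0]) q (by simpa only [LinearMap.toMatrix'_toLin'] using hC) fv gv hκ hf hg
    (by simpa only [LinearMap.toMatrix'_toLin'] using hGram) hα (by simpa only [LinearMap.toMatrix'_toLin'] using hrow)
    (by simpa only [LinearMap.toMatrix'_toLin'] using hcol) hρ hθ hcr0 hcc0
    (by simpa only [LinearMap.toMatrix'_toLin'] using hrow') (by simpa only [LinearMap.toMatrix'_toLin'] using hcol')
    (imagTimeWeight_nonneg hβ.le M)
  rw [hpre] at h
  obtain ⟨hunit, hbd⟩ := h
  -- `R = 1` on the support of `C`: dead variables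
  have hcov : ∀ X Y, Rf X * Rf Y * C X Y = C X Y := by
    intro X Y
    by_cases h0 : C X Y = 0
    · rw [h0, mul_zero]
    · obtain ⟨h1, h2⟩ := hCpl X Y h0
      rw [show Rf X = 1 from h1, show Rf Y = 1 from h2, one_mul, one_mul]
  -- `R = 1` on the support of `F′`: the analysis map absorbs `S_R`
  have hcomp : Matrix.toLin' (sectorAnalysisMatrix L M β F') ∘ₗ LinearMap.mulLeft ℂ Rf =
      Matrix.toLin' (sectorAnalysisMatrix L M β F') :=
    toLin'_sectorAnalysis_comp_mulLeft β F' Rf fun ω' K hK => hF'pl ω' K.1.1 hK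
  refine ⟨?_, fun m => ?_⟩
  · rw [effPartitionFn_map, toMatrix'_mulLeft, diagonal_transpose_mul_mul_diagonal] at hunit
    have hCe : (Matrix.of fun X Y => Rf X * Rf Y * C X Y) = C := by
      ext X Y
      exact hcov X Y
    rwa [hCe] at hunit
  · have hm := hbd m
    rwa [effAction_map_mulLeft_of_covariance ℂ Rf hcov, map_map_eq_map_comp, hcomp] at hm

/-- **The step in the sectorised `L¹–L^∞` norm, plateau form**: under the hypotheses of
`kernelNorm_sectorAnalysis_effAction_le_of_plateau`, for every degree `m + 1` and every constraint set `A`,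
`hubbardSectorKernelNorm β F' A (effAction C G) ≤ cr cc^m ε_x^m ρ^{-(m+1)} e‖Ṽ‖_h/(1-θ)`. [cite: BenfattoGiulianiMastropietro2006, §2.8 (2.77)] -/
theorem hubbardSectorKernelNorm_effAction_le_of_plateau {E : Type*} [NormedAddCommGroup E] [InnerProductSpace ℂ E]
    {β : ℝ} (hβ : 0 < β) (F Ft : Fin N → FreqMomentum L M → ℂ) (hFF : ∀ ω k, Ft ω k * F ω k = F ω k)
    (hF0 : ∀ k, ∑ ω, F ω k = 0 → ∀ ω, F ω k = 0)
    (F' : Fin N' → FreqMomentum L M → ℂ) (G : HubbardGrassmann L M) (hG : G ∈ evenPart ℂ (HubbardFieldIdx L M))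
    (hG0 : constPart ℂ G = 0)
    (C : Matrix (HubbardFieldIdx L M) (HubbardFieldIdx L M) ℂ)
    (hCpl : ∀ X Y, C X Y ≠ 0 → ∑ ω, F ω X.1.1 = 1 ∧ ∑ ω, F ω Y.1.1 = 1)
    (hF'pl : ∀ (ω' : Fin N') (k : FreqMomentum L M), F' ω' k ≠ 0 → ∑ ω, F ω k = 1)
    (q : SpaceTimeIdx L M × SectorLeg N → Bool)
    (hC : ∀ X Y, q X = q Y → ((sectorSubMatrix L M β Ft).transpose * C * sectorSubMatrix L M β Ft) X Y = 0)
    (fv gv : SpaceTimeIdx L M × SectorLeg N → E) {κ : ℝ} (hκ : 0 < κ) (hf : ∀ X, q X = true → ‖fv X‖ ≤ κ)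
    (hg : ∀ Y, q Y = false → ‖gv Y‖ ≤ κ)
    (hGram : ∀ X Y, q X = true → q Y = false →
      contr ℂ ((sectorSubMatrix L M β Ft).transpose * C * sectorSubMatrix L M β Ft) X Y = ⟪fv X, gv Y⟫_ℂ)
    {α : ℝ} (hα : 0 < α)
    (hrow : ∀ X, ∑ Y, ‖((sectorSubMatrix L M β Ft).transpose * C * sectorSubMatrix L M β Ft) X Y‖ ≤ α)
    (hcol : ∀ Y, ∑ X, ‖((sectorSubMatrix L M β Ft).transpose * C * sectorSubMatrix L M β Ft) X Y‖ ≤ α)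
    {ρ : ℝ} (hρ : 0 < ρ)
    (hθ : Real.exp 1 * α * normV (SpaceTimeIdx L M × SectorLeg N) κ ρ
      (fun m' => kernelNorm 1 (2 * m') (kernel ℂ (sectorPreimage β F G) (2 * m'))) / κ ^ 2 < 1)
    {cr cc : ℝ} (hcr0 : 0 ≤ cr) (hcc0 : 0 ≤ cc)
    (hrow' : ∀ X'', ∑ X', ‖(sectorAnalysisMatrix L M β F' * sectorSubMatrix L M β Ft) X'' X'‖ ≤ cr)
    (hcol' : ∀ X', ∑ X'', ‖(sectorAnalysisMatrix L M β F' * sectorSubMatrix L M β Ft) X'' X'‖ ≤ cc)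
    (m : ℕ) (A : Finset (Fin (m + 1) → SectorLeg N')) :
    hubbardSectorKernelNorm L M β F' A (effAction ℂ C G) ≤
      cr * cc ^ m * imagTimeWeight β M ^ m * (ρ⁻¹ ^ (m + 1) *
        (Real.exp 1 * normV (SpaceTimeIdx L M × SectorLeg N) κ ρ
          (fun m' => kernelNorm 1 (2 * m') (kernel ℂ (sectorPreimage β F G) (2 * m')))) /
          (1 - Real.exp 1 * α * normV (SpaceTimeIdx L M × SectorLeg N) κ ρ
            (fun m' => kernelNorm 1 (2 * m') (kernel ℂ (sectorPreimage β F G) (2 * m'))) / κ ^ 2)) :=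
  (hubbardSectorKernelNorm_le_kernelNorm_map hβ.le F' A _).trans
    ((kernelNorm_sectorAnalysis_effAction_le_of_plateau hβ F Ft hFF hF0 F' G hG hG0 C hCpl hF'pl q hC fv gv hκ hf hg hGram hα
      hrow hcol hρ hθ hcr0 hcc0 hrow' hcol').2 m)

/-- **S1, plateau form, with the input norm in the sectorised currency** (BGM 2006, (2.77)): with
`N̄(m') = ε_x · hubbardSectorKernelNorm β F univ G` (degree `2m'`), `‖G‖_h = normV Γ' κ ρ N̄`, `θ̄ = eα‖G‖_h/κ²`: if `θ̄ < 1`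
then `∫dμ_C e^{-G}` is a unit and, for every degree `m + 1` and constraint set `A`,
`hubbardSectorKernelNorm β F' A (effAction C G) ≤ cr cc^m ε_x^m ρ^{-(m+1)} e‖G‖_h/(1-θ̄)` — for EVERY even `G` without
constant part, the plateau of `F` being required only over the slice `C` and the output family `F′`.
[cite: BenfattoGiulianiMastropietro2006, §2.8 (2.77)] -/
theorem hubbardSectorKernelNorm_effAction_le_of_sectorNorm_of_plateau {E : Type*} [NormedAddCommGroup E]
    [InnerProductSpace ℂ E]
    {β : ℝ} (hβ : 0 < β) (F Ft : Fin N → FreqMomentum L M → ℂ) (hFF : ∀ ω k, Ft ω k * F ω k = F ω k)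
    (hF0 : ∀ k, ∑ ω, F ω k = 0 → ∀ ω, F ω k = 0)
    (F' : Fin N' → FreqMomentum L M → ℂ) (G : HubbardGrassmann L M) (hG : G ∈ evenPart ℂ (HubbardFieldIdx L M))
    (hG0 : constPart ℂ G = 0)
    (C : Matrix (HubbardFieldIdx L M) (HubbardFieldIdx L M) ℂ)
    (hCpl : ∀ X Y, C X Y ≠ 0 → ∑ ω, F ω X.1.1 = 1 ∧ ∑ ω, F ω Y.1.1 = 1)
    (hF'pl : ∀ (ω' : Fin N') (k : FreqMomentum L M), F' ω' k ≠ 0 → ∑ ω, F ω k = 1)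
    (q : SpaceTimeIdx L M × SectorLeg N → Bool)
    (hC : ∀ X Y, q X = q Y → ((sectorSubMatrix L M β Ft).transpose * C * sectorSubMatrix L M β Ft) X Y = 0)
    (fv gv : SpaceTimeIdx L M × SectorLeg N → E) {κ : ℝ} (hκ : 0 < κ) (hf : ∀ X, q X = true → ‖fv X‖ ≤ κ)
    (hg : ∀ Y, q Y = false → ‖gv Y‖ ≤ κ)
    (hGram : ∀ X Y, q X = true → q Y = false →
      contr ℂ ((sectorSubMatrix L M β Ft).transpose * C * sectorSubMatrix L M β Ft) X Y = ⟪fv X, gv Y⟫_ℂ)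
    {α : ℝ} (hα : 0 < α)
    (hrow : ∀ X, ∑ Y, ‖((sectorSubMatrix L M β Ft).transpose * C * sectorSubMatrix L M β Ft) X Y‖ ≤ α)
    (hcol : ∀ Y, ∑ X, ‖((sectorSubMatrix L M β Ft).transpose * C * sectorSubMatrix L M β Ft) X Y‖ ≤ α)
    {ρ : ℝ} (hρ : 0 < ρ)
    (hθ : Real.exp 1 * α * normV (SpaceTimeIdx L M × SectorLeg N) κ ρ
      (fun m' => imagTimeWeight β M *
        hubbardSectorKernelNorm L M β F (univ : Finset (Fin (2 * m') → SectorLeg N)) G) / κ ^ 2 < 1)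
    {cr cc : ℝ} (hcr0 : 0 ≤ cr) (hcc0 : 0 ≤ cc)
    (hrow' : ∀ X'', ∑ X', ‖(sectorAnalysisMatrix L M β F' * sectorSubMatrix L M β Ft) X'' X'‖ ≤ cr)
    (hcol' : ∀ X', ∑ X'', ‖(sectorAnalysisMatrix L M β F' * sectorSubMatrix L M β Ft) X'' X'‖ ≤ cc)
    (m : ℕ) (A : Finset (Fin (m + 1) → SectorLeg N')) :
    IsUnit (effPartitionFn ℂ C G) ∧
      hubbardSectorKernelNorm L M β F' A (effAction ℂ C G) ≤
        cr * cc ^ m * imagTimeWeight β M ^ m * (ρ⁻¹ ^ (m + 1) *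
          (Real.exp 1 * normV (SpaceTimeIdx L M × SectorLeg N) κ ρ
            (fun m' => imagTimeWeight β M *
              hubbardSectorKernelNorm L M β F (univ : Finset (Fin (2 * m') → SectorLeg N)) G)) /
            (1 - Real.exp 1 * α * normV (SpaceTimeIdx L M × SectorLeg N) κ ρ
              (fun m' => imagTimeWeight β M *
                hubbardSectorKernelNorm L M β F (univ : Finset (Fin (2 * m') → SectorLeg N)) G) / κ ^ 2)) := by
  set nV : ℝ := normV (SpaceTimeIdx L M × SectorLeg N) κ ρ
    (fun m' => kernelNorm 1 (2 * m') (kernel ℂ (sectorPreimage β F G) (2 * m'))) with hnV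
  set nVbar : ℝ := normV (SpaceTimeIdx L M × SectorLeg N) κ ρ (fun m' => imagTimeWeight β M *
    hubbardSectorKernelNorm L M β F (univ : Finset (Fin (2 * m') → SectorLeg N)) G) with hnVbar
  have hle : nV ≤ nVbar := normV_mono hκ.le hρ.le fun m' => kernelNorm_kernel_sectorPreimage_two_mul_le hβ.le F G hG0 m'
  have hnV0 : 0 ≤ nV := normV_nonneg hκ.le hρ.le fun m' => kernelNorm_nonneg zero_le_one _ _
  have hθ' : Real.exp 1 * α * nV / κ ^ 2 < 1 := lt_of_le_of_lt (by gcongr) hθ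
  obtain ⟨hunit, hstep⟩ := kernelNorm_sectorAnalysis_effAction_le_of_plateau hβ F Ft hFF hF0 F' G hG hG0 C hCpl hF'pl q hC
    fv gv hκ hf hg hGram hα hrow hcol hρ hθ' hcr0 hcc0 hrow' hcol'
  refine ⟨hunit, (hubbardSectorKernelNorm_le_kernelNorm_map hβ.le F' A _).trans ((hstep m).trans ?_)⟩
  have hB := step_bound_mono hκ hα hnV0 hle hθ
  have hε : 0 ≤ imagTimeWeight β M := imagTimeWeight_nonneg hβ.le M
  calc cr * cc ^ m * imagTimeWeight β M ^ m * (ρ⁻¹ ^ (m + 1) * (Real.exp 1 * nV) / (1 - Real.exp 1 * α * nV / κ ^ 2))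
      = cr * cc ^ m * imagTimeWeight β M ^ m * ρ⁻¹ ^ (m + 1) * (Real.exp 1 * nV / (1 - Real.exp 1 * α * nV / κ ^ 2)) := by
        ring
    _ ≤ cr * cc ^ m * imagTimeWeight β M ^ m * ρ⁻¹ ^ (m + 1) * (Real.exp 1 * nVbar / (1 - Real.exp 1 * α * nVbar / κ ^ 2)) :=
        mul_le_mul_of_nonneg_left hB (by positivity)
    _ = _ := by ring

end Step

/-! ### Transfer: inside any `F′`-measurement of the step, `G` may be replaced by the push-forward of its sector preimage

The two exact identities behind the plateau form, stated on their own so that ANY single-scale bound of the shape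
`… map g (effAction C (map f Ṽ)) …` (explicit Gram form `kernelNorm_kernel_map_effAction_le`, the determinant-bounded / graded /
weighted twins) transports to an arbitrary even input `G` under the plateau conditions: with `Ṽ = sectorPreimage β F G`,
`S = sectorSubMatrix β F̃`, `E = sectorAnalysisMatrix β F′`, the partition functions agree and the `E`-images of the effective
actions agree. -/

section Transfer

variable [NeZero M]

/-- **The partition function of the step does not see the plateau rescaling**: if the plateau function `Σ_ω F_ω` is `1` on
the momenta of the support of `C`, then `∫dμ_C e^{-map S(F̃) Ṽ} = ∫dμ_C e^{-G}`, `Ṽ = sectorPreimage β F G` (BGM 2006, (2.70): the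
sectorised representation integrates to the same numbers). [cite: BenfattoGiulianiMastropietro2006, §2.7 (2.70)] -/
theorem effPartitionFn_map_sectorSub_sectorPreimage_of_plateau {β : ℝ} (hβ : β ≠ 0) (F Ft : Fin N → FreqMomentum L M → ℂ)
    (hFF : ∀ ω k, Ft ω k * F ω k = F ω k) (hF0 : ∀ k, ∑ ω, F ω k = 0 → ∀ ω, F ω k = 0) (G : HubbardGrassmann L M)
    (C : Matrix (HubbardFieldIdx L M) (HubbardFieldIdx L M) ℂ)
    (hCpl : ∀ X Y, C X Y ≠ 0 → ∑ ω, F ω X.1.1 = 1 ∧ ∑ ω, F ω Y.1.1 = 1) :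
    effPartitionFn ℂ C (ExteriorAlgebra.map (Matrix.toLin' (sectorSubMatrix L M β Ft)) (sectorPreimage β F G)) =
      effPartitionFn ℂ C G := by
  set Rf : HubbardFieldIdx L M → ℂ := fun K => ∑ ω, F ω K.1.1 with hRf
  have hcov : ∀ X Y, Rf X * Rf Y * C X Y = C X Y := by
    intro X Y
    by_cases h0 : C X Y = 0
    · rw [h0, mul_zero]
    · obtain ⟨h1, h2⟩ := hCpl X Y h0
      rw [show Rf X = 1 from h1, show Rf Y = 1 from h2, one_mul, one_mul]
  have hCe : (Matrix.of fun X Y => Rf X * Rf Y * C X Y) = C := by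
    ext X Y
    exact hcov X Y
  rw [map_sectorSub_sectorPreimage_eq_map_mulLeft hβ F Ft hFF hF0 G, effPartitionFn_map, toMatrix'_mulLeft,
    diagonal_transpose_mul_mul_diagonal, hCe]

/-- **The measured output of the step does not see the plateau rescaling**: if `Σ_ω F_ω = 1` on the momenta of the support of
`C` and of the output family `F′`, then `map (toLin' E(F′)) (effAction C (map (toLin' S(F̃)) Ṽ)) = map (toLin' E(F′)) (effAction C G)`,
`Ṽ = sectorPreimage β F G` — every sectorised kernel of the new effective action may be computed from the sector representation of
an ARBITRARY even input (BGM 2006, (2.70)–(2.71)). [cite: BenfattoGiulianiMastropietro2006, §2.7 (2.70)–(2.71)] -/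
theorem map_sectorAnalysis_effAction_map_sectorPreimage_of_plateau {β : ℝ} (hβ : β ≠ 0)
    (F Ft : Fin N → FreqMomentum L M → ℂ) (hFF : ∀ ω k, Ft ω k * F ω k = F ω k)
    (hF0 : ∀ k, ∑ ω, F ω k = 0 → ∀ ω, F ω k = 0) (F' : Fin N' → FreqMomentum L M → ℂ) (G : HubbardGrassmann L M)
    (C : Matrix (HubbardFieldIdx L M) (HubbardFieldIdx L M) ℂ)
    (hCpl : ∀ X Y, C X Y ≠ 0 → ∑ ω, F ω X.1.1 = 1 ∧ ∑ ω, F ω Y.1.1 = 1)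
    (hF'pl : ∀ (ω' : Fin N') (k : FreqMomentum L M), F' ω' k ≠ 0 → ∑ ω, F ω k = 1) :
    ExteriorAlgebra.map (Matrix.toLin' (sectorAnalysisMatrix L M β F'))
        (effAction ℂ C (ExteriorAlgebra.map (Matrix.toLin' (sectorSubMatrix L M β Ft)) (sectorPreimage β F G))) =
      ExteriorAlgebra.map (Matrix.toLin' (sectorAnalysisMatrix L M β F')) (effAction ℂ C G) := by
  set Rf : HubbardFieldIdx L M → ℂ := fun K => ∑ ω, F ω K.1.1 with hRf
  have hcov : ∀ X Y, Rf X * Rf Y * C X Y = C X Y := by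
    intro X Y
    by_cases h0 : C X Y = 0
    · rw [h0, mul_zero]
    · obtain ⟨h1, h2⟩ := hCpl X Y h0
      rw [show Rf X = 1 from h1, show Rf Y = 1 from h2, one_mul, one_mul]
  have hcomp : Matrix.toLin' (sectorAnalysisMatrix L M β F') ∘ₗ LinearMap.mulLeft ℂ Rf =
      Matrix.toLin' (sectorAnalysisMatrix L M β F') :=
    toLin'_sectorAnalysis_comp_mulLeft β F' Rf fun ω' K hK => hF'pl ω' K.1.1 hK
  rw [map_sectorSub_sectorPreimage_eq_map_mulLeft hβ F Ft hFF hF0 G, effAction_map_mulLeft_of_covariance ℂ Rf hcov,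
    map_map_eq_map_comp, hcomp]

end Transfer

end Literature.MathematicalPhysics.QuantumLattice

end
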